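import Literature.Analysis.Complex.DbarBumpResidue
import Mathlib.Analysis.SpecialFunctions.Complex.LogDeriv
import Mathlib.Analysis.Calculus.ParametricIntegral
import Mathlib.Analysis.Calculus.MeanValue
import Mathlib.Analysis.Convex.Segment
import HarnessLib

/-!
# The cut logarithm of an arc and its `∂̄`-pairing with holomorphic differentials

Topic `Literature/Analysis/Complex`. This is the plane computation behind Forster's *weak
solutions* of the divisor `∂c = b - a` of an arc `c` from `a` to `b` inside a coordinate disc
(O. Forster, *Lectures on Riemann Surfaces*, §20.4–20.5), in the straight-arc case.

For `a b : ℂ` let (`arcLog`)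

  `w_{a,b}(z) = (2πi)⁻¹ log ((z - b)/(z - a))`     (principal branch).

Since `(z - b)/(z - a)` is a non-positive real number exactly when `z` lies on the segment
`[a, b]`, `w_{a,b}` is holomorphic on `ℂ ∖ [a, b]` (`hasDerivAt_arcLog`), and
`exp (2πi w_{a,b}(z)) = (z - b)/(z - a)` (`exp_two_pi_I_mul_arcLog`): this is Forster's function
"`(2πi)⁻¹ log` of `(z - b)/(z - a)`" of 20.4, whose exponential (after multiplication by a
cut-off `ρ = 1` near the segment) is the weak solution `u` of `∂c`, with
`u⁻¹ ∂̄u = 2πi · w ∂̄ρ` off `[a,b]`.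

The main result is the pairing formula of 20.5 in its plane form
(`integral_dbarAlong_mul_arcLog_mul_eq`): if `ρ ∈ C¹_c(ℂ)`, `supp ρ ⊆ U` open, `ρ = 1` on the
disc `B(z₀, r₁)`, `a, b ∈ B(z₀, r₀)` with `r₀ < r₁`, and `F` is holomorphic on `U` with
derivative `f`, then (`∂̄ = ½(∂ₓ + i∂_y)` = the tree's `dbarAlong 1`, `dA` = Lebesgue measure)

  `∫_ℂ ∂̄ρ(z) · w_{a,b}(z) f(z) dA(z) = (2i)⁻¹ (F(b) - F(a))`,

i.e. `∫∫ σ ∧ (f dz) = ∫_a^b f dz` with `σ = w ∂̄ρ dz̄` and `dz ∧ dz̄ = -2i dA` (Forster 20.5: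
`∫∫ σ_c ∧ ω = ∫_c ω`). Proof (replacing Forster's Stokes computation on the slit disc): both
sides vanish at `b = a`, and are holomorphic in `b ∈ B(z₀, r₀)` with the same derivative
`(2i)⁻¹ f(b)` — for the left side by differentiation under the integral sign
(`∂_b w_{a,b}(z) = -(2πi)⁻¹ (z - b)⁻¹`) followed by the Cauchy–Pompeiu formula
`∫ ∂̄φ(z) (z - b)⁻¹ dA = -π φ(b)` (`integral_dbarAlong_mul_inv_sub_eq`, Hörmander Thm. 1.2.1)
for `φ = ρ f`, whose `∂̄` is `f ∂̄ρ`.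

Everything is proved; there are no named facts.

## References

* O. Forster, *Lectures on Riemann Surfaces*, GTM 81, Springer (1981), §20.4 (weak solutions of
  `∂c`), Lemma 20.5 and part (a) of its proof (the pairing `∫_c ω = (2πi)⁻¹ ∫∫ (df/f) ∧ ω`).
  Held text `book:forsternd-lectures-reimann-surfaces` (scan pp. 134–136). [Forster1981]
* L. Hörmander, *An Introduction to Complex Analysis in Several Variables*, 2nd ed. (1973),
  Thm. 1.2.1. [HormanderSCV1973]
-/

noncomputable section

open MeasureTheory Set Filter Function Complex Metric Topology
open scoped Real

namespace Literature.Analysis.Complex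

/-! ### The cut logarithm `w_{a,b}` -/

/-- **The cut logarithm of the pair `(a, b)`**: `w_{a,b}(z) = (2πi)⁻¹ log ((z - b)/(z - a))`
(principal branch of `log`; value `0` at `z = a` and `z = b` by the conventions `x/0 = 0`,
`log 0 = 0`). Holomorphic off the segment `[a, b]`, with `exp (2πi w_{a,b}) = (z - b)/(z - a)`.
[cite: Forster1981, §20.4] -/
def arcLog (a b z : ℂ) : ℂ := (2 * π * I)⁻¹ * Complex.log ((z - b) / (z - a))

/-- The normalising constant `2πi` is nonzero. [folklore] -/
private theorem two_pi_I_ne_zero : (2 * π * I : ℂ) ≠ 0 :=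
  mul_ne_zero (mul_ne_zero two_ne_zero (ofReal_ne_zero.2 Real.pi_ne_zero)) I_ne_zero

/-- `w_{a,a} = 0`. [cite: Forster1981, §20.4] -/
@[simp] theorem arcLog_self (a z : ℂ) : arcLog a a z = 0 := by
  unfold arcLog
  by_cases h : z = a
  · simp [h]
  · rw [div_self (sub_ne_zero.2 h), Complex.log_one, mul_zero]

/-- `exp (2πi w_{a,b}(z)) = (z - b)/(z - a)` for `z ≠ a, b`. [cite: Forster1981, §20.4] -/
theorem exp_two_pi_I_mul_arcLog {a b z : ℂ} (ha : z ≠ a) (hb : z ≠ b) :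
    Complex.exp (2 * π * I * arcLog a b z) = (z - b) / (z - a) := by
  unfold arcLog
  rw [← mul_assoc, mul_inv_cancel₀ two_pi_I_ne_zero, one_mul]
  exact Complex.exp_log (div_ne_zero (sub_ne_zero.2 hb) (sub_ne_zero.2 ha))

/-- **The cut of `w_{a,b}` is the segment `[a, b]`**: for `z ∉ [a, b]` the quotient
`(z - b)/(z - a)` lies in the slit plane `ℂ ∖ (-∞, 0]`. [cite: Forster1981, §20.4] -/
theorem div_mem_slitPlane_of_not_mem_segment {a b z : ℂ} (hz : z ∉ segment ℝ a b) :
    (z - b) / (z - a) ∈ slitPlane := by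
  have hza : z ≠ a := fun h ↦ hz (h ▸ left_mem_segment ℝ z b)
  by_contra hq
  rw [Complex.mem_slitPlane_iff, not_or, not_lt, not_ne_iff] at hq
  obtain ⟨hre, him⟩ := hq
  set q : ℂ := (z - b) / (z - a) with hq_def
  set x : ℝ := q.re with hx_def
  have hq_real : q = (x : ℂ) := Complex.ext (by simp [hx_def]) (by simp [him])
  have key : (x : ℂ) * (z - a) = z - b := by
    rw [← hq_real, hq_def]
    exact div_mul_cancel₀ _ (sub_ne_zero.2 hza)
  have h1x : (0 : ℝ) < 1 - x := by linarith
  apply hz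
  rw [mem_segment_iff_div]
  refine ⟨-x, 1, by linarith, zero_le_one, by linarith, ?_⟩
  rw [Complex.real_smul, Complex.real_smul]
  have h1x' : ((-x + 1 : ℝ) : ℂ) ≠ 0 := ofReal_ne_zero.2 (by linarith)
  push_cast at h1x' ⊢
  field_simp
  linear_combination key

/-- Points off the segment differ from its endpoints. [folklore] -/
private theorem ne_left_of_not_mem_segment {a b z : ℂ} (hz : z ∉ segment ℝ a b) : z ≠ a :=
  fun h ↦ hz (h ▸ left_mem_segment ℝ z b)

/-- Points off the segment differ from its endpoints. [folklore] -/
private theorem ne_right_of_not_mem_segment {a b z : ℂ} (hz : z ∉ segment ℝ a b) : z ≠ b :=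
  fun h ↦ hz (h ▸ right_mem_segment ℝ a z)

/-- **`w_{a,b}` is holomorphic off `[a, b]`**, with
`w_{a,b}'(z) = (2πi)⁻¹ ((z - b)⁻¹ - (z - a)⁻¹)`. [cite: Forster1981, §20.4] -/
theorem hasDerivAt_arcLog {a b z : ℂ} (hz : z ∉ segment ℝ a b) :
    HasDerivAt (arcLog a b) ((2 * π * I)⁻¹ * ((z - b)⁻¹ - (z - a)⁻¹)) z := by
  have hza : z - a ≠ 0 := sub_ne_zero.2 (ne_left_of_not_mem_segment hz)
  have hzb : z - b ≠ 0 := sub_ne_zero.2 (ne_right_of_not_mem_segment hz)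
  have h1 : HasDerivAt (fun z ↦ (z - b) / (z - a))
      ((1 * (z - a) - (z - b) * 1) / (z - a) ^ 2) z :=
    ((hasDerivAt_id z).sub_const b).div ((hasDerivAt_id z).sub_const a) hza
  have h2 := (h1.clog (div_mem_slitPlane_of_not_mem_segment hz)).const_mul (2 * π * I)⁻¹
  have key : (z - b)⁻¹ - (z - a)⁻¹ =
      (1 * (z - a) - (z - b) * 1) / (z - a) ^ 2 / ((z - b) / (z - a)) := by
    field_simp
  unfold arcLog
  rw [key]
  exact h2

/-- `w_{a,b}` is complex differentiable off `[a, b]`. [cite: Forster1981, §20.4] -/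
theorem differentiableAt_arcLog {a b z : ℂ} (hz : z ∉ segment ℝ a b) :
    DifferentiableAt ℂ (arcLog a b) z :=
  (hasDerivAt_arcLog hz).differentiableAt

/-- `w_{a,b}` is holomorphic on `ℂ ∖ [a, b]`. [cite: Forster1981, §20.4] -/
theorem differentiableOn_arcLog (a b : ℂ) :
    DifferentiableOn ℂ (arcLog a b) (segment ℝ a b)ᶜ :=
  fun _ hz ↦ (differentiableAt_arcLog hz).differentiableWithinAt

/-- Segments in `ℂ` are closed. [folklore] -/
private theorem isClosed_segment (a b : ℂ) : IsClosed (segment ℝ a b) := by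
  rw [segment_eq_image']
  exact (isCompact_Icc.image
    (continuous_const.add (continuous_id.smul continuous_const))).isClosed

/-- `w_{a,b}` is `C^∞` (over `ℝ`) at every point off `[a, b]`. [cite: Forster1981, §20.4] -/
theorem contDiffAt_arcLog {a b z : ℂ} (hz : z ∉ segment ℝ a b) {n : WithTop ℕ∞} :
    ContDiffAt ℝ n (arcLog a b) z := by
  have hopen : IsOpen (segment ℝ a b)ᶜ := (isClosed_segment a b).isOpen_compl
  have han : AnalyticAt ℂ (arcLog a b) z :=
    (differentiableOn_arcLog a b).analyticAt (hopen.mem_nhds hz)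
  exact (han.contDiffAt.of_le le_top).restrict_scalars ℝ

/-- `∂̄ w_{a,b} = 0` off `[a, b]`. [cite: Forster1981, §20.4] -/
theorem dbarAlong_arcLog_eq_zero {a b z : ℂ} (hz : z ∉ segment ℝ a b) :
    dbarAlong 1 (arcLog a b) z = 0 :=
  dbarAlong_eq_zero_of_differentiableAt (differentiableAt_arcLog hz) 1

/-- **Derivative of `w_{a,b}(z)` in the endpoint `b`**: `∂_b w_{a,b}(z) = -(2πi)⁻¹ (z - b)⁻¹`
for `z ∉ [a, b]`. [cite: Forster1981, §20.5] -/
theorem hasDerivAt_arcLog_right {a b z : ℂ} (hz : z ∉ segment ℝ a b) :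
    HasDerivAt (fun b ↦ arcLog a b z) (-((2 * π * I)⁻¹ * (z - b)⁻¹)) b := by
  have hza : z - a ≠ 0 := sub_ne_zero.2 (ne_left_of_not_mem_segment hz)
  have hzb : z - b ≠ 0 := sub_ne_zero.2 (ne_right_of_not_mem_segment hz)
  have h1 : HasDerivAt (fun b ↦ (z - b) / (z - a)) (-1 / (z - a)) b :=
    ((hasDerivAt_id b).const_sub z).div_const (z - a)
  have h2 := (h1.clog (div_mem_slitPlane_of_not_mem_segment hz)).const_mul (2 * π * I)⁻¹
  have key : -((2 * π * I)⁻¹ * (z - b)⁻¹) =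
      (2 * π * I)⁻¹ * (-1 / (z - a) / ((z - b) / (z - a))) := by
    field_simp
  unfold arcLog
  rw [key]
  exact h2

/-! ### Cut-offs equal to one on a disc -/

section CutOff

variable {ρ : ℂ → ℂ} {U : Set ℂ} {z₀ : ℂ} {r₁ : ℝ}

/-- `∂̄ρ = 0` on an open disc where `ρ = 1` (Forster: `f₀ = 1`, whence `df₀/f₀ = 0`, where the
cut-off is constant). [cite: Forster1981, §20.5, proof (a)] -/
theorem dbarAlong_eq_zero_of_eqOn_ball (hρ1 : ∀ z ∈ ball z₀ r₁, ρ z = 1) {z : ℂ}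
    (hz : z ∈ ball z₀ r₁) : dbarAlong 1 ρ z = 0 := by
  have h : ρ =ᶠ[𝓝 z] fun _ ↦ 1 := by
    filter_upwards [isOpen_ball.mem_nhds hz] with w hw using hρ1 w hw
  exact (dbarAlong_eventuallyEq_zero_of_eventuallyEq_const h).self_of_nhds

/-- A point where `∂̄ρ ≠ 0` lies outside the disc where `ρ = 1`. [folklore] -/
private theorem not_mem_ball_of_dbarAlong_ne_zero (hρ1 : ∀ z ∈ ball z₀ r₁, ρ z = 1) {z : ℂ}
    (hz : dbarAlong 1 ρ z ≠ 0) : z ∉ ball z₀ r₁ :=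
  fun h ↦ hz (dbarAlong_eq_zero_of_eqOn_ball hρ1 h)

/-- A point where `∂̄ρ ≠ 0` lies in any open set containing `supp ρ`. [folklore] -/
private theorem mem_of_dbarAlong_ne_zero (hρU : tsupport ρ ⊆ U) {z : ℂ} (hz : dbarAlong 1 ρ z ≠ 0) :
    z ∈ U := by
  by_contra h
  exact hz (dbarAlong_eq_zero_of_notMem hρU h)

/-- The disc where `ρ = 1` lies in any set containing `supp ρ`. [folklore] -/
private theorem ball_subset_of_eqOn_ball (hρU : tsupport ρ ⊆ U) (hρ1 : ∀ z ∈ ball z₀ r₁, ρ z = 1) :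
    ball z₀ r₁ ⊆ U := fun z hz ↦
  hρU (subset_tsupport ρ (by simp [mem_support, hρ1 z hz]))

/-- **Continuity of `∂̄ρ · v` for `v` continuous near `supp ∂̄ρ`.** If `ρ ∈ C¹`, `supp ρ ⊆ U`,
`ρ = 1` on an open disc `V` and `v` is continuous at every point of `U ∖ V`, then `∂̄ρ · v` is
continuous on `ℂ` (it vanishes near `V` and near `Uᶜ`; Forster's remark "since `df/f = 0` on
`X ∖ U`, the integral over `X` exists"). [cite: Forster1981, §20.5, Remark] -/
theorem continuous_dbarAlong_mul_of_eqOn_ball (hρ : ContDiff ℝ 1 ρ) (hρU : tsupport ρ ⊆ U)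
    (hρ1 : ∀ z ∈ ball z₀ r₁, ρ z = 1) {v : ℂ → ℂ}
    (hv : ∀ z ∈ U, z ∉ ball z₀ r₁ → ContinuousAt v z) :
    Continuous fun s ↦ dbarAlong 1 ρ s * v s := by
  rw [continuous_iff_continuousAt]
  intro s
  by_cases hsV : s ∈ ball z₀ r₁
  · have h0 : (fun s ↦ dbarAlong 1 ρ s * v s) =ᶠ[𝓝 s] fun _ ↦ 0 := by
      filter_upwards [isOpen_ball.mem_nhds hsV] with z hz
      rw [dbarAlong_eq_zero_of_eqOn_ball hρ1 hz, zero_mul]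
    exact continuousAt_const.congr h0.symm
  by_cases hsU : s ∈ U
  · exact ((continuous_dbarAlong_one hρ).continuousAt).mul (hv s hsU hsV)
  · have hs' : s ∉ tsupport ρ := fun h ↦ hsU (hρU h)
    have h0 : (fun s ↦ dbarAlong 1 ρ s * v s) =ᶠ[𝓝 s] fun _ ↦ 0 := by
      filter_upwards [(isClosed_tsupport ρ).isOpen_compl.mem_nhds hs'] with z hz
      rw [dbarAlong_eq_zero_of_notMem_tsupport hz, zero_mul]
    exact continuousAt_const.congr h0.symm

/-- Integrability of `∂̄ρ · v` under the hypotheses of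
`continuous_dbarAlong_mul_of_eqOn_ball`, for `ρ` of compact support ("the integral over `X`
exists"). [cite: Forster1981, §20.5, Remark] -/
theorem integrable_dbarAlong_mul_of_eqOn_ball (hρ : ContDiff ℝ 1 ρ) (hρc : HasCompactSupport ρ)
    (hρU : tsupport ρ ⊆ U) (hρ1 : ∀ z ∈ ball z₀ r₁, ρ z = 1) {v : ℂ → ℂ}
    (hv : ∀ z ∈ U, z ∉ ball z₀ r₁ → ContinuousAt v z) :
    Integrable fun s ↦ dbarAlong 1 ρ s * v s :=
  (continuous_dbarAlong_mul_of_eqOn_ball hρ hρU hρ1 hv).integrable_of_hasCompactSupport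
    (hasCompactSupport_dbarAlong_mul hρc v)

end CutOff

/-! ### The pairing formula -/

/-- Holomorphic functions on an open set are `C¹` over `ℝ` there. [folklore] -/
private theorem contDiffOn_real_of_differentiableOn_isOpen {g : ℂ → ℂ} {U : Set ℂ} (hU : IsOpen U)
    (hg : DifferentiableOn ℂ g U) {n : WithTop ℕ∞} : ContDiffOn ℝ n g U :=
  ((hg.analyticOnNhd hU).contDiffOn hU.uniqueDiffOn (n := n)).restrict_scalars ℝ

/-- **Cauchy–Pompeiu against `f ∂̄ρ`**: if `ρ ∈ C¹_c`, `supp ρ ⊆ U` open and `f` is holomorphic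
on `U`, then `∫ ∂̄ρ(z) f(z) (z - c)⁻¹ dA(z) = -π ρ(c) f(c)` for every `c ∈ ℂ` (the formula
`∫ ∂̄φ (z - c)⁻¹ dA = -π φ(c)` for `φ = ρ f`, whose `∂̄` is `f ∂̄ρ`).
[cite: HormanderSCV1973, Thm. 1.2.1] -/
theorem integral_dbarAlong_mul_mul_inv_sub_eq {ρ f : ℂ → ℂ} {U : Set ℂ} (hU : IsOpen U)
    (hρ : ContDiff ℝ 1 ρ) (hρc : HasCompactSupport ρ) (hρU : tsupport ρ ⊆ U)
    (hf : DifferentiableOn ℂ f U) (c : ℂ) :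
    ∫ z, dbarAlong 1 ρ z * (f z * (z - c)⁻¹) = -π * (ρ c * f c) := by
  set φ : ℂ → ℂ := fun s ↦ ρ s * f s with hφ_def
  have hφ : ContDiff ℝ 1 φ :=
    contDiff_mul_of_tsupport_subset hU hρ hρU (contDiffOn_real_of_differentiableOn_isOpen hU hf)
  have hφc : HasCompactSupport φ := hρc.mul_right
  have hdbar : ∀ s, dbarAlong 1 φ s = dbarAlong 1 ρ s * f s := by
    intro s
    by_cases hs : s ∈ U
    · have hfd : DifferentiableAt ℂ f s := hf.differentiableAt (hU.mem_nhds hs)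
      rw [hφ_def, dbarAlong_one_mul (hρ.differentiable one_ne_zero s)
        (hfd.restrictScalars ℝ), dbarAlong_eq_zero_of_differentiableAt hfd, mul_zero, add_zero]
    · have hφU : tsupport φ ⊆ U := (tsupport_mul_subset_left).trans hρU
      rw [dbarAlong_eq_zero_of_notMem hφU hs, dbarAlong_eq_zero_of_notMem hρU hs, zero_mul]
  have hP := integral_dbarAlong_mul_inv_sub_eq hφ hφc c
  simp only [hdbar, mul_assoc] at hP
  rw [hP]

/-- **The `∂̄`-pairing of the cut logarithm (Forster 20.5, plane form).** Let `ρ ∈ C¹_c(ℂ)` with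
`supp ρ ⊆ U` open and `ρ = 1` on `B(z₀, r₁)`, let `a, b ∈ B(z₀, r₀)` with `r₀ < r₁`, and let `F`
be holomorphic on `U` with derivative `f`. Then

  `∫_ℂ ∂̄ρ(z) · w_{a,b}(z) f(z) dA(z) = (2i)⁻¹ (F(b) - F(a))`,

that is `∫∫ σ ∧ f dz = ∫_{[a,b]} f dz` for `σ = w_{a,b} ∂̄ρ dz̄` (`dz ∧ dz̄ = -2i dA`): the smooth
form `σ`, supported in the annulus `supp ∂̄ρ`, pairs with holomorphic differentials like the
current of integration along the arc. Both sides vanish at `b = a` and have the same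
`b`-derivative `(2i)⁻¹ f(b)` (differentiation under the integral, then Cauchy–Pompeiu for `ρ f`).
[cite: Forster1981, §20.5] -/
theorem integral_dbarAlong_mul_arcLog_mul_eq {ρ F f : ℂ → ℂ} {U : Set ℂ} {z₀ a b : ℂ}
    {r₀ r₁ : ℝ} (hU : IsOpen U) (hF : ∀ z ∈ U, HasDerivAt F (f z) z)
    (hρ : ContDiff ℝ 1 ρ) (hρc : HasCompactSupport ρ) (hρU : tsupport ρ ⊆ U)
    (h₀₁ : r₀ < r₁) (hρ1 : ∀ z ∈ ball z₀ r₁, ρ z = 1) (ha : a ∈ ball z₀ r₀)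
    (hb : b ∈ ball z₀ r₀) :
    ∫ z, dbarAlong 1 ρ z * (arcLog a b z * f z) = (2 * I)⁻¹ * (F b - F a) := by
  -- notation and elementary geometry
  set B : Set ℂ := ball z₀ r₀ with hB
  set V : Set ℂ := ball z₀ r₁ with hV
  have hBV : B ⊆ V := ball_subset_ball h₀₁.le
  have hVU : V ⊆ U := ball_subset_of_eqOn_ball hρU hρ1
  have hBU : B ⊆ U := hBV.trans hVU
  have hFd : DifferentiableOn ℂ F U := fun z hz ↦ (hF z hz).differentiableAt.differentiableWithinAt
  have hFan : AnalyticOnNhd ℂ F U := hFd.analyticOnNhd hU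
  have hf_eq : EqOn f (deriv F) U := fun z hz ↦ (hF z hz).deriv.symm
  have hfd : DifferentiableOn ℂ f U :=
    (hFan.deriv.differentiableOn).congr hf_eq
  have hfc : ∀ z ∈ U, ContinuousAt f z := fun z hz ↦
    (hfd.differentiableAt (hU.mem_nhds hz)).continuousAt
  -- off `V`, points are far from `B` and from segments with endpoints in `B`
  have hseg : ∀ {β z : ℂ}, β ∈ B → z ∉ V → z ∉ segment ℝ a β := fun hβ hz h ↦
    hz (hBV ((convex_ball z₀ r₀).segment_subset ha hβ h))
  have hdist : ∀ {β z : ℂ}, β ∈ B → z ∉ V → r₁ - r₀ ≤ ‖z - β‖ := by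
    intro β z hβ hz
    rw [hB, mem_ball, dist_eq_norm] at hβ
    rw [hV, mem_ball, dist_eq_norm, not_lt] at hz
    have h := norm_sub_le_norm_sub_add_norm_sub z β z₀
    linarith
  -- the parametrised integral and its derivative
  set Φ : ℂ → ℂ := fun β ↦ ∫ z, dbarAlong 1 ρ z * (arcLog a β z * f z) with hΦ
  set G : ℂ → ℂ → ℂ := fun β z ↦ dbarAlong 1 ρ z * (arcLog a β z * f z) with hG
  set G' : ℂ → ℂ → ℂ :=
    fun β z ↦ dbarAlong 1 ρ z * (-((2 * π * I)⁻¹ * (z - β)⁻¹) * f z) with hG'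
  have hGc : ∀ β ∈ B, Continuous (G β) := fun β hβ ↦
    continuous_dbarAlong_mul_of_eqOn_ball hρ hρU hρ1 fun z hzU hzV ↦
      ((differentiableAt_arcLog (hseg hβ hzV)).continuousAt).mul (hfc z hzU)
  have hGi : ∀ β ∈ B, Integrable (G β) := fun β hβ ↦
    (hGc β hβ).integrable_of_hasCompactSupport (hasCompactSupport_dbarAlong_mul hρc _)
  have hG'c : ∀ β ∈ B, Continuous (G' β) := fun β hβ ↦
    continuous_dbarAlong_mul_of_eqOn_ball hρ hρU hρ1 fun z hzU hzV ↦ by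
      have hzβ : z - β ≠ 0 := sub_ne_zero.2 fun h ↦ hzV (hBV (h ▸ hβ))
      exact ((continuousAt_const.mul ((continuousAt_id.sub continuousAt_const).inv₀
        hzβ)).neg).mul (hfc z hzU)
  -- the dominating function
  set bound : ℂ → ℝ := fun z ↦ ‖dbarAlong 1 ρ z * f z‖ * (‖(2 * π * I : ℂ)⁻¹‖ * (r₁ - r₀)⁻¹)
    with hbound
  have hbound_int : Integrable bound := by
    have hc : Continuous fun z ↦ dbarAlong 1 ρ z * f z :=
      continuous_dbarAlong_mul_of_eqOn_ball hρ hρU hρ1 fun z hzU _ ↦ hfc z hzU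
    exact ((hc.integrable_of_hasCompactSupport
      (hasCompactSupport_dbarAlong_mul hρc _)).norm).mul_const _
  have h_bound : ∀ z, ∀ β ∈ B, ‖G' β z‖ ≤ bound z := by
    intro z β hβ
    by_cases h0 : dbarAlong 1 ρ z = 0
    · simp [hG', hbound, h0]
    have hzV : z ∉ V := not_mem_ball_of_dbarAlong_ne_zero hρ1 h0
    have hd := hdist hβ hzV
    have hr : (0 : ℝ) < r₁ - r₀ := sub_pos.2 h₀₁
    have hinv : ‖(z - β)⁻¹‖ ≤ (r₁ - r₀)⁻¹ := by
      rw [norm_inv]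
      exact inv_anti₀ hr hd
    calc ‖G' β z‖ = ‖dbarAlong 1 ρ z * f z‖ * (‖(2 * π * I : ℂ)⁻¹‖ * ‖(z - β)⁻¹‖) := by
          simp only [hG', norm_mul, norm_neg]; ring
      _ ≤ bound z := by
          simp only [hbound]
          gcongr
  have h_diff : ∀ z, ∀ β ∈ B, HasDerivAt (fun β ↦ G β z) (G' β z) β := by
    intro z β hβ
    by_cases h0 : dbarAlong 1 ρ z = 0
    · have h1 : (fun β ↦ G β z) = fun _ ↦ 0 := by funext β; simp [hG, h0]
      have h2 : G' β z = 0 := by simp [hG', h0]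
      rw [h1, h2]
      exact hasDerivAt_const β 0
    have hzV : z ∉ V := not_mem_ball_of_dbarAlong_ne_zero hρ1 h0
    exact ((hasDerivAt_arcLog_right (hseg hβ hzV)).mul_const (f z)).const_mul _
  -- differentiation under the integral sign
  have hderiv : ∀ β ∈ B, HasDerivAt Φ (∫ z, G' β z) β := by
    intro β₀ hβ₀
    have hBn : B ∈ 𝓝 β₀ := isOpen_ball.mem_nhds hβ₀
    have hmeas : ∀ᶠ β in 𝓝 β₀, AEStronglyMeasurable (G β) volume := by
      filter_upwards [hBn] with β hβ using (hGc β hβ).aestronglyMeasurable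
    exact (hasDerivAt_integral_of_dominated_loc_of_deriv_le hBn hmeas (hGi β₀ hβ₀)
      (hG'c β₀ hβ₀).aestronglyMeasurable (Eventually.of_forall h_bound) hbound_int
      (Eventually.of_forall h_diff)).2
  -- the derivative is `(2i)⁻¹ f(β)` by Cauchy–Pompeiu
  have hderiv_eq : ∀ β ∈ B, ∫ z, G' β z = (2 * I)⁻¹ * f β := by
    intro β hβ
    have hP := integral_dbarAlong_mul_mul_inv_sub_eq hU hρ hρc hρU hfd β
    rw [hρ1 β (hBV hβ), one_mul] at hP
    have hG'_eq : (fun z ↦ G' β z) =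
        fun z ↦ -(2 * π * I)⁻¹ * (dbarAlong 1 ρ z * (f z * (z - β)⁻¹)) := by
      funext z; simp only [hG']; ring
    rw [hG'_eq, integral_const_mul, hP]
    have hπ : (π : ℂ) ≠ 0 := ofReal_ne_zero.2 Real.pi_ne_zero
    field_simp
  -- `Φ - (2i)⁻¹ F` is constant on the disc `B`
  set Ψ : ℂ → ℂ := fun β ↦ Φ β - (2 * I)⁻¹ * F β with hΨ
  have hΨd : ∀ β ∈ B, HasDerivAt Ψ 0 β := by
    intro β hβ
    have h := (hderiv β hβ).sub ((hF β (hBU hβ)).const_mul (2 * I)⁻¹)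
    rwa [hderiv_eq β hβ, sub_self] at h
  have hconst : Ψ b = Ψ a :=
    isOpen_ball.is_const_of_deriv_eq_zero (convex_ball z₀ r₀).isPreconnected
      (fun β hβ ↦ (hΨd β hβ).differentiableAt.differentiableWithinAt)
      (fun β hβ ↦ (hΨd β hβ).deriv) hb ha
  have hΦa : Φ a = 0 := by simp [hΦ]
  have hmain : Φ b = (2 * I)⁻¹ * (F b - F a) := by
    simp only [hΨ, hΦa, zero_sub] at hconst
    linear_combination hconst
  exact hmain

end Literature.Analysis.Complex
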